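import Summits.RiemannHypothesis.RiemannHypothesis.Theses.WeilComb
import Summits.RiemannHypothesis.RiemannHypothesis.Theorems.WeilCombCombShapePositivityFejerOfCrux
import Summits.RiemannHypothesis.RiemannHypothesis.Theorems.WeilCombCombShapePositivityStubFejerConvSquare
import Summits.RiemannHypothesis.RiemannHypothesis.Theorems.WeilCombCombShapePositivityEffectiveWindow
import Summits.RiemannHypothesis.RiemannHypothesis.Theorems.WeilCombCombShapeDetection
import Literature.NumberTheory.LFunctions.WeilCriterionConverse
import Mathlib.Topology.Algebra.Order.Archimedean

/-!
# Stub-ideation k = 2 (FAMILY 2 — RESHAPE) for `stub_fejer` (C⁺) of line `Sketch`,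
crux `WeilComb.CombShapePositivity` (stmt-RiemannHypothesis-11229)

Typed companion of `STUB-IDEAS-stub_fejer-2.md`: the stub's verbatim signature is packaged as `StubFejer`
(`stubFejer_iff_verbatim : StubFejer ↔ <verbatim> := Iff.rfl`), and every PROPOSED HELPER LEMMA of the plan is
stated over existing declarations with `sorry` (statements only; elaboration sanity, no proofs). Nothing here is
registered; the skeleton `Lines/Sketch.lean` is untouched.

Status used: `stub_fejer ↔ RiemannHypothesis` is LANDED (`WeilCombFejerConvSquare.fejer_iff_riemannHypothesis`),
as are the Fejér bookkeeping identity (`WeilCombFejerBoxIdentity.stubFejer_lhs_eq_fejerSum`), the cell transfer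
(`WeilCombBohrFejer.fejer_of_cell`), the unconditional corner (`fejer_subcritical`) and co-finality
(`combShapePositivity_iff_cofinal`). The reshapes below are therefore equivalence-web / structure lemmas, each
≤ one prover cycle, plus the two assemblies `stubFejer_of_riemannHypothesis'` (Plan A) and
`stubFejer_of_fejerAt_pair` (Plan B).
-/

noncomputable section

set_option linter.dupNamespace false

open scoped BigOperators ComplexConjugate Topology
open Complex Filter

namespace Summit.RiemannHypothesis.RiemannHypothesis.Cruxes.CombShapePositivity.StubFejerIdeas2

open Literature.NumberTheory.LFunctions
open Literature.NumberTheory.LFunctions.WeilConverse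
open Summit.RiemannHypothesis.RiemannHypothesis.Theses.WeilComb

/-! ## §0 Notation (all `def`s unfold to the stub's verbatim sub-terms) -/

/-- `φ_ε(t) = ε⁻¹ φ₀(t/ε)`, `φ₀(u) = expNegInvGlue (1 - u²)`. [folklore] -/
def bumpDil (ε : ℝ) : ℝ → ℂ :=
  fun t : ℝ => (ε : ℂ)⁻¹ * ((expNegInvGlue (1 - (t / ε) ^ 2) : ℝ) : ℂ)

/-- `ψ_ε = φ_ε ⋆ φ̃_ε`. [folklore] -/
def autocorr (ε : ℝ) : ℝ → ℂ := weilConv (bumpDil ε) (weilReflect (bumpDil ε))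

/-- The comb symbol `w_ε(x) = W(τ_x ψ_ε)`. [folklore] -/
def symbol (ε : ℝ) (x : ℝ) : ℂ := weilFunctional (weilTranslate (autocorr ε) x)

/-- The Bohr character `χ_θ(d) = exp(i Σ_{p∈S} θ_p v_p(d))`. [folklore] -/
def bohrChar (S : Finset ℕ) (θ : ℕ → ℝ) (d : ℕ) : ℂ :=
  Complex.exp (I * ((∑ p ∈ S, θ p * (d.factorization p : ℝ) : ℝ) : ℂ))

/-- The stub's left-hand side (before `.re`): the twisted divisor-box form at level `N = ∏_{p∈S} p^n`. [folklore] -/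
def fejerBox (ε : ℝ) (S : Finset ℕ) (n : ℕ) (θ : ℕ → ℝ) : ℂ :=
  ∑ d ∈ (∏ p ∈ S, p ^ n).divisors, ∑ d' ∈ (∏ p ∈ S, p ^ n).divisors,
    bohrChar S θ d * conj (bohrChar S θ d') * symbol ε (Real.log (d : ℝ) - Real.log (d' : ℝ))

/-- C⁺ at one `(ε, S)`: all boxes `n`, all twists `θ`. [folklore] -/
def FejerAt (ε : ℝ) (S : Finset ℕ) : Prop := ∀ (n : ℕ) (θ : ℕ → ℝ), 0 ≤ (fejerBox ε S n θ).re

/-- The registered stub `stub_fejer`, packaged. [folklore] -/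
def StubFejer : Prop := ∀ ε : ℝ, 0 < ε → ∀ S : Finset ℕ, (∀ p ∈ S, p.Prime) → FejerAt ε S

/-- Sanity: `StubFejer` is the verbatim registered signature (definitional unfolding only). [folklore] -/
theorem stubFejer_iff_verbatim : StubFejer ↔
    (∀ ε : ℝ, 0 < ε → ∀ S : Finset ℕ, (∀ p ∈ S, p.Prime) → ∀ (n : ℕ) (θ : ℕ → ℝ),
      0 ≤ (∑ d ∈ (∏ p ∈ S, p ^ n).divisors, ∑ d' ∈ (∏ p ∈ S, p ^ n).divisors,
        Complex.exp (I * ((∑ p ∈ S, θ p * (d.factorization p : ℝ) : ℝ) : ℂ)) *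
          conj (Complex.exp (I * ((∑ p ∈ S, θ p * (d'.factorization p : ℝ) : ℝ) : ℂ))) *
          weilFunctional (weilTranslate
            (weilConv (fun t : ℝ => (ε : ℂ)⁻¹ * ((expNegInvGlue (1 - (t / ε) ^ 2) : ℝ) : ℂ))
              (weilReflect (fun t : ℝ => (ε : ℂ)⁻¹ * ((expNegInvGlue (1 - (t / ε) ^ 2) : ℝ) : ℂ))))
            (Real.log (d : ℝ) - Real.log (d' : ℝ)))).re) :=
  Iff.rfl

/-- Cross-check with the landed equivalence: `StubFejer ↔ RiemannHypothesis`. [folklore] -/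
theorem stubFejer_iff_riemannHypothesis : StubFejer ↔ RiemannHypothesis :=
  stubFejer_iff_verbatim.trans
    Summit.RiemannHypothesis.RiemannHypothesis.Theorems.WeilCombFejerConvSquare.fejer_iff_riemannHypothesis

/-! ## Plan A — REFORMULATE: the explicit formula in Bohr coordinates (zero-side product formula) -/

/-- The per-prime twist `u_p(ρ, θ) = exp(i θ_p + (ρ − ½) log p)` (unimodular iff `Re ρ = ½`, for `p ≥ 2`). [folklore] -/
def twist (θ : ℕ → ℝ) (ρ : ℂ) (p : ℕ) : ℂ :=
  Complex.exp (I * (θ p : ℂ) + (ρ - 1 / 2) * (Real.log (p : ℝ) : ℂ))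

/-- The Dirichlet-kernel product `K_n(u) = (Σ_{j≤n} u^j)(Σ_{k≤n} u^{-k})`; for `|u| = 1` it is the Fejér
kernel value `|Σ_{j≤n} u^j|² ≥ 0`. [folklore] -/
def dirichletProd (n : ℕ) (u : ℂ) : ℂ :=
  (∑ j ∈ Finset.range (n + 1), u ^ j) * (∑ k ∈ Finset.range (n + 1), u⁻¹ ^ k)

/-- **A1 (S/M).** The comb symbol IS the zero-side exponential series of `φ_ε`:
`w_ε(x) = B_{φ_ε}(x) = Σ_ρ m(ρ) φ̂_ε(ρ) conj φ̂_ε(1−ρ̄) e^{(ρ−½)x}` (absolutely convergent).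
Route: `explicit_formula_holds` on the test `τ_x ψ_ε`, `weilMellin_weilTranslate`, `weilMellin_weilQuadratic`,
`hasWeilZeroSide_tsum` (+ `summable_pairCoeff_mul_cexp`), `tendsto_nhds_unique`. [folklore] -/
theorem symbol_eq_expSum {ε : ℝ} (hε : 0 < ε) (x : ℝ) : symbol ε x = expSum (bumpDil ε) x := by
  sorry

/-- **A2 (S).** `K_n(u) = |Σ_{j≤n} u^j|²` for unimodular `u` (then `u⁻¹ = conj u`). [folklore] -/
theorem dirichletProd_of_norm_eq_one (n : ℕ) {u : ℂ} (hu : ‖u‖ = 1) :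
    dirichletProd n u = ((‖∑ j ∈ Finset.range (n + 1), u ^ j‖ ^ 2 : ℝ) : ℂ) := by
  sorry

/-- **A3 (S).** `|u_p(ρ, θ)| = p^{Re ρ − ½}`; in particular `|u_p| = 1 ↔ Re ρ = ½` for `p ≥ 2`. [folklore] -/
theorem norm_twist (θ : ℕ → ℝ) (ρ : ℂ) {p : ℕ} (hp : 2 ≤ p) :
    ‖twist θ ρ p‖ = (p : ℝ) ^ (ρ.re - 1 / 2) := by
  sorry

/-- **A4 (M) — ZERO-SIDE PRODUCT FORMULA.** For `ε > 0`, a finite set of primes `S`, `n`, `θ`: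
`fejerBox ε S n θ = Σ_ρ m(ρ) P_{φ_ε}(ρ) ∏_{p∈S} K_n(u_p(ρ, θ))` (absolutely convergent `tsum` over the
non-trivial zeros). Route: A1 termwise, `Summable.tsum_finsetSum` (finite double sum ↔ tsum), and the
box factorisation `Σ_{d ∣ N} χ_θ(d) d^{ρ−½} = ∏_p Σ_{j≤n} u_p^j` (`Nat.factorization` on the prime box,
`WeilCombFejerBoxIdentity.factorization_primeBox`). [folklore] -/
theorem fejerBox_eq_tsum_zeros {ε : ℝ} (hε : 0 < ε) {S : Finset ℕ} (hS : ∀ p ∈ S, p.Prime) (n : ℕ)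
    (θ : ℕ → ℝ) :
    fejerBox ε S n θ =
      ∑' ρ : ZetaZeros.riemannZetaNontrivialZeros,
        (riemannZetaZeroOrder (ρ : ℂ) : ℂ) * pairCoeff (bumpDil ε) ρ *
          ∏ p ∈ S, dirichletProd n (twist θ ρ p) := by
  sorry

/-- **A5 (S).** On the critical line every term of A4 is a nonnegative real:
`m(ρ) ≥ 0`, `P_{φ_ε}(ρ) = |φ̂_ε(ρ)|²` (`weilMellin_weilQuadratic_of_re_eq`), `K_n(u_p) = |·|²` (A2, A3). [folklore] -/
theorem term_nonneg_of_re_eq_half {ε : ℝ} (hε : 0 < ε) (S : Finset ℕ) (hS : ∀ p ∈ S, p.Prime) (n : ℕ)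
    (θ : ℕ → ℝ) {ρ : ℂ} (hρ : ρ ∈ ZetaZeros.riemannZetaNontrivialZeros) (hre : ρ.re = 1 / 2) :
    0 ≤ ((riemannZetaZeroOrder ρ : ℂ) * pairCoeff (bumpDil ε) ρ * ∏ p ∈ S, dirichletProd n (twist θ ρ p)).re ∧
      ((riemannZetaZeroOrder ρ : ℂ) * pairCoeff (bumpDil ε) ρ * ∏ p ∈ S, dirichletProd n (twist θ ρ p)).im = 0 := by
  sorry

/-- **Plan A assembly (S given A4, A5): RH ⇒ C⁺, transparently** (re-derives the landed
`fejer_of_riemannHypothesis` from the product formula: `tsum` of nonnegative reals, `tsum_nonneg` on `re`). [folklore] -/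
theorem stubFejer_of_riemannHypothesis' (hRH : RiemannHypothesis) : StubFejer := by
  sorry

/-! ## Plan B — CHANGE THE QUANTIFIER ORDER: two primes already carry the whole stub -/

/-- **B1 (S/M).** The lag lattice of `S = {2, 3}` is dense: `ℤ log 2 + ℤ log 3` is a non-cyclic additive subgroup of
`ℝ` (`2^a ≠ 3^b`), hence dense (`AddSubgroup.dense_or_cyclic`). [folklore] -/
theorem dense_latticeLog23 :
    Dense (Set.range fun z : ℤ × ℤ => (z.1 : ℝ) * Real.log 2 + (z.2 : ℝ) * Real.log 3) := by
  sorry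

/-- **B2 (M).** Fejér positivity at `(ε, S)` for all LARGE boxes bounds the symbol on the `S`-unit lattice by its value
at `0` (the `2 × 2` minors): the Fourier coefficient of a nonnegative trigonometric polynomial is bounded by its
mean — `∏_p (n+1−|h_p|) |w_ε(⟨h, log p⟩)| ≤ (n+1)^{|S|} w_ε(0)`, then `n → ∞`; grid averaging over
`θ ∈ (2π/L)ℤ^S` as in `stub_reduction` (roots-of-unity orthogonality), symbol real (`SymbolRealEven`). [folklore] -/
theorem norm_symbol_le_of_fejerAt {ε : ℝ} (hε : 0 < ε) {S : Finset ℕ} (hS : ∀ p ∈ S, p.Prime)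
    (hF : ∀ᶠ n in atTop, ∀ θ : ℕ → ℝ, 0 ≤ (fejerBox ε S n θ).re) {d d' : ℕ} (hd : d ≠ 0) (hd' : d' ≠ 0)
    (hdS : d.primeFactors ⊆ S) (hd'S : d'.primeFactors ⊆ S) :
    ‖symbol ε (Real.log (d : ℝ) - Real.log (d' : ℝ))‖ ≤ (symbol ε 0).re := by
  sorry

/-- **B3 (S).** A bound for the continuous series `B_Φ` (`combShapeDetection_continuous_expSum`) on a DENSE set of
lags holds everywhere (`isClosed_le` + `Dense.closure_eq`); generalises `combShapeDetection_le_of_forall_log_nat_sub`. [folklore] -/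
theorem norm_expSum_le_of_dense {Φ : ℝ → ℂ} (hΦ : IsWeilTest Φ) {D : Set ℝ} (hD : Dense D) {Q : ℝ}
    (h : ∀ x ∈ D, ‖expSum Φ x‖ ≤ Q) (x : ℝ) : ‖expSum Φ x‖ ≤ Q := by
  sorry

/-- **B4 (S, reuse).** Detection from a uniform bound on `B_{φ_ε}` at EVERY small `ε`: no off-line zero
(`combShapeDetection_order_mul_pairCoeff_eq_zero`, `combShapeDetection_re_weilMellin_shapeBump_pos` with
`ε = 1/(1+|γ|)`, `riemannHypothesis_iff_strip_holds`) — the body of `combShapeDetection_re_eq_one_half`. [folklore] -/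
theorem riemannHypothesis_of_expSum_bounded
    (h : ∀ ε : ℝ, 0 < ε → ε ≤ 1 → ∃ Q : ℝ, ∀ x : ℝ, ‖expSum (bumpDil ε) x‖ ≤ Q) :
    RiemannHypothesis := by
  sorry

/-- **Plan B assembly (S given B1–B4, A1): the `|S|`-induction collapses** — C⁺ on the single torus `T^{{2,3}}`
(all `ε`) implies RH, hence C⁺ on every torus (`fejer_of_riemannHypothesis`). [folklore] -/
theorem stubFejer_of_fejerAt_pair (h : ∀ ε : ℝ, 0 < ε → FejerAt ε {2, 3}) : StubFejer := by
  sorry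

/-! ## Plan C — SPLIT INTO REGIMES in the box size `n` (fixed `ε`, `S`) -/

/-- **C1 (S).** The effective unconditional corner: `ε · ∏_{p∈S} p^n ≤ 1/128 ⇒ 0 ≤ Re fejerBox`
(`fejer_of_cell` + the landed effective window `WeilCombBohrFejer.stub_windowSub`; `1/40` once
`stub_windowSub40` lands). Makes `fejer_subcritical`'s `c₀` explicit. [folklore] -/
theorem fejerBox_re_nonneg_of_window {ε : ℝ} (hε : 0 < ε) {S : Finset ℕ} (hS : ∀ p ∈ S, p.Prime) (n : ℕ)
    (θ : ℕ → ℝ) (hwin : ε * ((∏ p ∈ S, p ^ n : ℕ) : ℝ) ≤ 1 / 128) : 0 ≤ (fejerBox ε S n θ).re := by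
  sorry

/-- **C2 (S given Plan B machinery).** Every family of boxes co-final in `n` (at each `ε`, `S`) is the whole stub —
the `n`-analogue of `combShapePositivity_iff_cofinal`: no induction on `n` has content. [folklore] -/
theorem stubFejer_iff_eventually (n₀ : ℝ → Finset ℕ → ℕ) :
    StubFejer ↔ ∀ ε : ℝ, 0 < ε → ∀ S : Finset ℕ, (∀ p ∈ S, p.Prime) →
      ∀ n : ℕ, n₀ ε S ≤ n → ∀ θ : ℕ → ℝ, 0 ≤ (fejerBox ε S n θ).re := by
  sorry

/-! ## Plan D — DE-ARITHMETISE (Bochner on `ℝ`): C⁺ = "the comb symbol is of positive type" -/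

/-- `w_ε` is a positive-definite function on `ℝ` (finite Hermitian forms at arbitrary real nodes). [folklore] -/
def SymbolPosDef (ε : ℝ) : Prop :=
  ∀ (k : ℕ) (x : Fin k → ℝ) (c : Fin k → ℂ),
    0 ≤ (∑ i, ∑ j, c i * conj (c j) * symbol ε (x i - x j)).re

/-- **D1 (M).** `StubFejer ↔ ∀ ε > 0, SymbolPosDef ε`. `⇐`: nodes `log d`, coefficients `χ_θ(d)`.
`⇒`: C⁺ ⇒ crux (`combShapePositivity_iff_fejer`) = positivity at nodes `log m`; real nodes `x_i` are
simultaneous limits of `log ⌈N e^{x_i}⌉ − log N`, the form is translation invariant in the nodes and `w_ε`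
is continuous (A1 + `combShapeDetection_continuous_expSum`). (Alternative `⇒` through RH: real-node combs are
Weil tests.) New certificate language: Bochner — `w_ε = μ̂_ε`, `μ_ε ≥ 0` finite; under RH
`μ_ε = Σ_γ m |φ̂_ε(½+iγ)|² δ_γ` (A1). [folklore] -/
theorem stubFejer_iff_symbolPosDef : StubFejer ↔ ∀ ε : ℝ, 0 < ε → SymbolPosDef ε := by
  sorry

/-- **D2 (S given D1/B2).** Cheap necessary conditions of positive type, usable by the disprover at ARBITRARY real
lags (not only `log(m/m')`): `|w_ε(x)| ≤ w_ε(0)`. [folklore] -/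
theorem norm_symbol_le_of_stubFejer (h : StubFejer) {ε : ℝ} (hε : 0 < ε) (x : ℝ) :
    ‖symbol ε x‖ ≤ (symbol ε 0).re := by
  sorry

end Summit.RiemannHypothesis.RiemannHypothesis.Cruxes.CombShapePositivity.StubFejerIdeas2

end
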